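import Summits.HubbardSuperconductivity.HubbardSuperconductivity.Theorems.AnisotropyChordTransferFibre3C0Perm
import Summits.HubbardSuperconductivity.HubbardSuperconductivity.Theorems.AnisotropyChordTransferFibre3RowDMonoTransform

/-!
# Route `AnisotropyChord` / H0 rotor rung, row D (KT-2a): the low coefficients `R̂′(k)` are REAL

For an even pair profile `f` the `K₁` trial state `Ψ¹ = v·Π⁰` satisfies `Ψ¹(−c) = conj Ψ¹(c)` (`v(−c) = conj v(c)`, `Π⁰` even and real),
the fibre Hamiltonian commutes with this inversion–conjugation (`nnList` is symmetric, `W(−c) = W(c)`, `D` is symmetric), hence the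
off-`D` residual `R′ = 1_{Dᶜ}(H − ε₁ − T⁺)Ψ¹` has `R′(−c) = conj R′(c)` (★ `resid_neg_conj`) and every configuration-space Fourier
coefficient is real: ★ `cfgDFT_conj_of_neg_conj`, ★★ `rhat_im_zero : (cfgDFT (resid L Δ f) k₂ k₃).im = 0`, so that
`‖R̂′(k)‖ = |Re R̂′(k)|` (★ `rhat_norm_eq_abs_re`) — the row-D evaluator may drop the imaginary channel of its `RExpr` pairs.
Prover seat `hubbard-h0-rotor-p1` g30 (route lead); helper for piece A = stmt-HubbardSuperconductivity-23918 of rung 19089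
(`--supports`, helper class).  Nothing here proves superconductivity in the Hubbard model; lemmas for ONE row of ONE conditional reduction;
the rotor TARGET as originally worded stays FALSE (g15 verdict).  Tree imports only; no sorry.
-/

set_option linter.dupNamespace false
set_option autoImplicit false

open scoped BigOperators

namespace Summit.HubbardSuperconductivity.HubbardSuperconductivity.Theorems.AnisotropyChord.Transfer.Fibre3

namespace RowD

variable (L : ℕ) [NeZero L]

/-- `Ψ¹(−c) = conj Ψ¹(c)` for an even profile. [folklore] -/
theorem trialK1_neg_conj {f : Tor L → ℝ} (hev : ∀ r : Tor L, f (-r) = f r) (c : Cfg L) :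
    trialK1 L f (-c) = (starRingEnd ℂ) (trialK1 L f c) := by
  obtain ⟨a, b⟩ := c
  unfold trialK1 vfun prodState
  simp only [Prod.neg_mk, map_mul, map_add, map_one, conj_phase, Complex.conj_ofReal]
  rw [hev, hev, show -b - -a = -(b - a) by abel, hev]

omit [NeZero L] in
/-- argument bookkeeping: `F` at a point equals `conj F` at the negated point. [folklore] -/
theorem F_eq_conj_neg {F : Cfg L → ℂ} (hF : ∀ c : Cfg L, F (-c) = (starRingEnd ℂ) (F c)) (x y x' y' : Tor L)
    (hx : x = -x') (hy : y = -y') : F (x, y) = (starRingEnd ℂ) (F (x', y')) := by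
  rw [← hF, Prod.neg_mk, ← hx, ← hy]

/-- the free fibre hopping commutes with inversion–conjugation. [folklore] -/
theorem H0apply_neg_conj (K : Tor L) {F : Cfg L → ℂ} (hF : ∀ c : Cfg L, F (-c) = (starRingEnd ℂ) (F c)) (c : Cfg L) :
    H0apply L K F (-c) = (starRingEnd ℂ) (H0apply L K F c) := by
  obtain ⟨a, b⟩ := c
  unfold H0apply
  simp only [Prod.neg_mk, nnList_map_sum_complex, map_sub, map_mul, map_add, map_ofNat, map_one,
    map_div₀, conj_phase, neg_neg]
  have E := fun (x y x' y' : Tor L) (hx : x = -x') (hy : y = -y') => F_eq_conj_neg L hF x y x' y' hx hy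
  rw [E (-a) (-b) a b rfl rfl,
    E (-a + ex L) (-b) (a + -ex L) b (by abel) rfl, E (-a + -ex L) (-b) (a + ex L) b (by abel) rfl,
    E (-a + ey L) (-b) (a + -ey L) b (by abel) rfl, E (-a + -ey L) (-b) (a + ey L) b (by abel) rfl,
    E (-a) (-b + ex L) a (b + -ex L) rfl (by abel), E (-a) (-b + -ex L) a (b + ex L) rfl (by abel),
    E (-a) (-b + ey L) a (b + -ey L) rfl (by abel), E (-a) (-b + -ey L) a (b + ey L) rfl (by abel),
    E (-a - ex L) (-b - ex L) (a - -ex L) (b - -ex L) (by abel) (by abel),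
    E (-a - -ex L) (-b - -ex L) (a - ex L) (b - ex L) (by abel) (by abel),
    E (-a - ey L) (-b - ey L) (a - -ey L) (b - -ey L) (by abel) (by abel),
    E (-a - -ey L) (-b - -ey L) (a - ey L) (b - ey L) (by abel) (by abel)]
  ring

/-- the interacting fibre Hamiltonian likewise. [folklore] -/
theorem Happly_neg_conj (K : Tor L) (Δ : ℝ) {F : Cfg L → ℂ} (hF : ∀ c : Cfg L, F (-c) = (starRingEnd ℂ) (F c)) (c : Cfg L) :
    Happly L K Δ F (-c) = (starRingEnd ℂ) (Happly L K Δ F c) := by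
  unfold Happly
  rw [H0apply_neg_conj L K hF c, ShellRow.Wcount_neg, hF c]
  simp only [map_sub, map_mul, Complex.conj_ofReal, map_natCast]

/-- ★ the off-`D` residual of the trial state: `R′(−c) = conj R′(c)` (even profile). [folklore] -/
theorem resid_neg_conj {Δ : ℝ} {f : Tor L → ℝ} (hev : ∀ r : Tor L, f (-r) = f r) (c : Cfg L) :
    resid L Δ f (-c) = (starRingEnd ℂ) (resid L Δ f c) := by
  unfold resid residual
  rw [ShellRow.InD_neg]
  by_cases hD : InD L c = true
  · simp [hD]
  · simp only [hD]
    rw [Happly_neg_conj L (K1 L) Δ (trialK1_neg_conj L hev) c, trialK1_neg_conj L hev c]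
    simp only [map_sub, map_mul, Complex.conj_ofReal, Bool.false_eq_true, if_false]

/-- ★ a configuration function with `R(−c) = conj R(c)` has conjugation-invariant (hence real) Fourier coefficients. [folklore] -/
theorem cfgDFT_conj_of_neg_conj {R : Cfg L → ℂ} (hR : ∀ c : Cfg L, R (-c) = (starRingEnd ℂ) (R c)) (k₂ k₃ : Tor L) :
    (starRingEnd ℂ) (cfgDFT L R k₂ k₃) = cfgDFT L R k₂ k₃ := by
  unfold cfgDFT
  rw [map_sum]
  -- conjugate termwise and reindex `c ↦ −c`
  have hterm : ∀ c : Cfg L, (starRingEnd ℂ) ((starRingEnd ℂ) (phase L k₂ c.1 * phase L k₃ c.2) * R c)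
      = (starRingEnd ℂ) (phase L k₂ (-c).1 * phase L k₃ (-c).2) * R (-c) := by
    intro c
    simp only [map_mul, conj_phase, hR, Prod.fst_neg, Prod.snd_neg, neg_neg]
  simp_rw [hterm]
  exact Fintype.sum_equiv (Equiv.neg (Cfg L)) _ _ (fun c => rfl)

/-- ★★ THE LOW COEFFICIENTS ARE REAL: `Im R̂′(k₂,k₃) = 0` for a ground (even) profile. [folklore] -/
theorem rhat_im_zero {Δ lam2 : ℝ} {f : Tor L → ℝ} (hf : IsGroundTwoMagnon L Δ lam2 f) (k₂ k₃ : Tor L) :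
    (cfgDFT L (resid L Δ f) k₂ k₃).im = 0 := by
  have h := cfgDFT_conj_of_neg_conj L (resid_neg_conj L (Δ := Δ) hf.2.1) k₂ k₃
  exact Complex.conj_eq_iff_im.mp h

/-- ★ hence `‖R̂′(k)‖ = |Re R̂′(k)|`. [folklore] -/
theorem rhat_norm_eq_abs_re {Δ lam2 : ℝ} {f : Tor L → ℝ} (hf : IsGroundTwoMagnon L Δ lam2 f) (k₂ k₃ : Tor L) :
    ‖cfgDFT L (resid L Δ f) k₂ k₃‖ = |(cfgDFT L (resid L Δ f) k₂ k₃).re| := by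
  have him := rhat_im_zero L hf k₂ k₃
  rw [← Complex.re_add_im (cfgDFT L (resid L Δ f) k₂ k₃), him]
  simp

end RowD

end Summit.HubbardSuperconductivity.HubbardSuperconductivity.Theorems.AnisotropyChord.Transfer.Fibre3
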